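import Literature.AnabelianGeometry.SemiGraphs.PSCSeparatingCoverings
import Literature.AnabelianGeometry.SemiGraphs.PSCVertexQuotientExistenceProofs
import Literature.AnabelianGeometry.SemiGraphs.PSCVertexQuotientConverseProofs
import Literature.AnabelianGeometry.SemiGraphs.PSCRamificationSplitInjection
import Literature.AnabelianGeometry.SemiGraphs.PSCCoveringBranchDataProofs
import Literature.AnabelianGeometry.SemiGraphs.PSCCoveringDatumSturdyAt
import HarnessLib

/-!
# [CombGC] Prop. 1.2, proof p. 9: the VERTICIAL separating coverings from [IUTchI] Rmk. 1.2.3 (iv) at sturdy levels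

Mochizuki, *A combinatorial version of the Grothendieck conjecture*, Tohoku Math. J. **59** (2007)
[CombGC], proof of Proposition 1.2, author's manuscript p. 9: "it suffices to prove, under the further
assumption that `G` is sturdy [cf. Remark 1.1.5], that if `v₁ ≠ v₂` …, then there exists a finite
étale … covering `G' → G` whose restriction to the anabelioid `G_{v₂}` is trivial …, but whose
restriction to the anabelioid `G_{v₁}` is nontrivial.  But, in light of our assumption that `G` is
sturdy, one verifies immediately that by gluing together appropriate finite étale coverings of the
anabelioids `G_v`, `G_e`, one may construct a finite étale covering `G' → G` with the desired
properties" [cite: MochizukiCombGC2007, Prop 1.2 proof p.9]; and *Inter-universal Teichmüller theory I*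
[IUTchI], Remark 1.2.3 (iv), kurims manuscript p. 42: for sturdy `G` "the inclusions
`M^unr_G[v] ⊆ M^unr_G` … determine a split injection `⊕_v M^unr_G[v] ↪ M^unr_G`", the vertex
quotients `M^unr-vert_G ↠ M^unr_G[v] ⊗ F_l` being "[nontrivial!]" [cite: Mochizuki2012, IUTchI Rmk 1.2.3(iv) p.42].

PROOF-ONLY file (abc-iut cell, FACT-LIST row F-2826 `PSCDatum.VerticialSeparatingCoverings`, typed
by abc-iut-w4-d081 in `PSCSeparatingCoverings.lean` as the origin-level input P12-L01-V of the
Prop. 1.2 sub-DAG; its universal closure over the bare interface is refuted in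
`PSCSeparatingCoveringsNegative.lean`).  Here the row is DERIVED, for every datum on a profinite
group, from inputs the cell already carries BY NAME for [CombGC] Thm. 1.6 (iii)
(`PSCThm16iiiAssemblyProofs.unrVerticialIff_holds_of_inputs`): at a finite étale `Π_G`-covering
`G_V` (the covering datum `G.restrictBD V hV bd` of `PSCCoveringBranchData.lean`) which is sturdy and
satisfies Rmk. 1.2.3 (iv)'s split injection (`UnrVerticialSplitInjection'`, the corrected successor of
`PSCRamificationSplitInjection.lean`) and Rmk. 1.1.5's rank statement (`UnrVertAbOfRank`), the
"appropriate finite étale covering" separating two distinct vertices `w₁ ≠ w₂` of `G_V` is the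
ABELIAN one recorded by the kernel `H' ⊴ Π_{G_V}` of the elementary abelian quotient
`M^unr_{G_V} ↠ M^unr_{G_V}[w₁] ⊗ F_l` (`exists_isElemAbUnrQuotient_inf_eq_vertexQuotientKer`): it
contains `Π_{w}` for every `w ≠ w₁` and does not contain `Π_{w₁}` (`vertexQuotientKer_ne_unrVertAb`):

1. `exists_openNormal_vertGp_le_not_le` — one level: for a sturdy datum on a profinite group with the
   two inputs, distinct vertices are separated by an open normal subgroup;
2. `exists_separating_of_restrictBD` — transfer through `Π_{G_V} = V ↪ Π_G`: the level-`V` clause of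
   `VerticialSeparatingCoverings` (vertices of `G_V` over `v` = double cosets `V \ Π_G / Π_v`, vertex
   groups `V ∩ γ Π_v γ⁻¹` up to `V`-conjugacy: `restrictBD_vertGp_vertexOver_le_iff`, `vertexOver_eq_imp`);
3. `verticialSeparatingCoverings_of_levelwise` / `_of_sturdy` — **F-2826 for every datum on a profinite
   group admitting, below every open normal `V`, a sturdy covering level with the two inputs** (for
   sturdy `G` every level is sturdy, `IsSturdy.restrictBD`);
4. `verticialSeparatingCoverings_of_origin` (`'`, `_frozen`) — **over an origin predicate `Ω`: every
   `Ω`-datum satisfies F-2826, granted BY NAME "coverings of PSC-type data are of PSC-type"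
   (`RestrictBDOfPSCTypeHolds Ω`), Rmk. 1.1.5 (`SturdyCoverHolds Ω`: a sturdy characteristic level
   exists, and rank-sturdy = genus-sturdy), Rmk. 1.2.3 (iv) (`UnrVerticialCharacterizationHolds' Ω`, or
   the frozen `UnrVerticialCharacterizationHolds Ω`), Rmk. 1.1.5 (`UnrVertAbOfRankHolds Ω`) and
   profiniteness (displayed `hprof`, as in `PSCSeparatingCoveringsProofs2.lean`)** — i.e. the verticial
   third of row P12-L01 is no longer an independent origin-level assumption;
(Instance forms of rows F-2826–F-2830 at the one-vertex / smooth-proper shape, where every level has a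
single vertex and nothing is to be separated, are in `PSCSeparatingCoveringsSmoothProper.lean`.)

The EDGE-LIKE case (row F-2827) is NOT derived here: separating two edges needs the structure of the
edge part `M^edge` of `M_G` ([CombGC] Prop. 1.3 / the cusp relation), which the tree does not type;
it stays an origin-level statement consumed by name.  0 definitions; plain profinite group theory over
the interface; typed ≠ proved for the inputs; nothing here takes a side on [IUTchIII] Cor. 3.12.
-/

namespace Literature.AnabelianGeometry.SemiGraphs

namespace PSCDatum

open scoped Pointwise
open PSCCovering

universe u

variable {P : Type u} [Group P] [TopologicalSpace P] [IsTopologicalGroup P]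

/-! ### 1. One level: an open normal subgroup containing `Π_{w₂}` but not `Π_{w₁}` -/

section Level

variable [CompactSpace P] [T2Space P]

/-- **One level** ([CombGC] Prop. 1.2 proof p. 9, "in light of our assumption that `G` is sturdy …
one may construct a finite étale covering … trivial over `G_{v₂}` … nontrivial over `G_{v₁}`", via
[IUTchI] Rmk. 1.2.3 (iv)): for a sturdy datum on a profinite group satisfying the split injection and the
rank statement, and vertices `w₁ ≠ w₂`, the kernel `H` of the elementary abelian quotient
`M^unr_G ↠ M^unr_G[w₁] ⊗ F_l` is an open normal subgroup with `Π_{w₂} ⊆ H` and `Π_{w₁} ⊄ H`.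
[cite: MochizukiCombGC2007, Prop 1.2 proof p.9] -/
theorem exists_openNormal_vertGp_le_not_le (G : PSCDatum P)
    (hsplit : G.UnrVerticialSplitInjection) (hrank : G.UnrVertAbOfRank) (hGs : G.IsSturdy)
    {w₁ w₂ : G.graph.V} (hne : w₁ ≠ w₂) :
    ∃ H : Subgroup P, H.Normal ∧ IsOpen (H : Set P) ∧ G.vertGp w₂ ≤ H ∧ ¬ G.vertGp w₁ ≤ H := by
  obtain ⟨l, hlS⟩ := G.sigma_nonempty
  have hl : l.Prime := G.sigma_prime l hlS
  obtain ⟨H, hH, -, hinf⟩ :=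
    G.exists_isElemAbUnrQuotient_inf_eq_vertexQuotientKer hsplit hrank hGs hl hlS w₁
  refine ⟨H, hH.1, hH.2.1, ?_, fun h₁ => ?_⟩
  · exact (G.vertGp_le_vertexQuotientKer l hne.symm).trans (hinf ▸ inf_le_right)
  · have hall : ∀ w, G.vertGp w ≤ H := fun w => by
      by_cases hw : w = w₁
      · exact hw ▸ h₁
      · exact (G.vertGp_le_vertexQuotientKer l hw).trans (hinf ▸ inf_le_right)
    have hle : G.unrVertAb ≤ H := G.unrVertAb_le_of_forall_vertGp_le hH.2.1 hH.2.2.1 hall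
    exact G.vertexQuotientKer_ne_unrVertAb hsplit hrank hGs hlS w₁
      (by rw [← hinf]; exact inf_eq_left.mpr hle)

end Level

/-! ### 2. Transfer to the covering datum `G_V = G.restrictBD V hV bd` -/

section Restrict

variable (G : PSCDatum P) (V : Subgroup P) [V.FiniteIndex] (hV : IsOpen (V : Set P)) (bd : G.BranchData)

omit [TopologicalSpace P] [IsTopologicalGroup P] [V.FiniteIndex] in
/-- `k K k⁻¹ = K` for `k ∈ K` (private copy of the lemma of `PSCCoveringDatum.lean`). [folklore] -/
private theorem toConjAct_smul_eq_self_of_mem {K : Subgroup P} {k : P} (hk : k ∈ K) :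
    ConjAct.toConjAct k • K = K := by
  ext b
  rw [Subgroup.mem_pointwise_smul_iff_inv_smul_mem, ← ConjAct.toConjAct_inv, ConjAct.smul_def,
    ConjAct.ofConjAct_toConjAct, inv_inv]
  constructor
  · intro hb
    have hb' := K.mul_mem (K.mul_mem hk hb) (K.inv_mem hk)
    simpa [mul_assoc] using hb'
  · intro hb
    exact K.mul_mem (K.mul_mem (K.inv_mem hk) hb) hk

omit [IsTopologicalGroup P] in
/-- The representative verticial subgroup of `G_V` at the vertex `V x Π_v` through `x` is a
`V`-conjugate of the trace `V ∩ x Π_v x⁻¹` (the enumeration picks the representative `u x k`,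
`u ∈ V`, `k ∈ Π_v`). [cite: MochizukiCombGC2007, Def 1.1(ii) p.6] -/
theorem exists_restrictVertGp_vertexOver_eq (v : G.graph.V) (x : P) :
    ∃ u : V, G.restrictVertGp V (G.vertexOver V v x) =
      ConjAct.toConjAct u • (ConjAct.toConjAct x • G.vertGp v).subgroupOf V := by
  obtain ⟨u, hu, k, hk, hrep⟩ := exists_dcRep_dcIdx_eq V (G.vertGp v) x
  refine ⟨⟨u, hu⟩, ?_⟩
  rw [conj_subgroupOf_eq, Subgroup.coe_mk]
  unfold restrictVertGp vrep vertexOver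
  dsimp only
  rw [hrep, map_mul, map_mul, mul_smul, mul_smul, toConjAct_smul_eq_self_of_mem hk]

omit [IsTopologicalGroup P] in
/-- Equal level-`V` vertices `V x₁ Π_{v₁} = V x₂ Π_{v₂}` have `v₁ = v₂` and equal double cosets.
[cite: MochizukiCombGC2007, Def 1.1(ii) p.6] -/
theorem vertexOver_eq_imp {v₁ v₂ : G.graph.V} {x₁ x₂ : P}
    (h : G.vertexOver V v₁ x₁ = G.vertexOver V v₂ x₂) :
    v₁ = v₂ ∧ DoubleCoset.doubleCoset x₁ (V : Set P) (G.vertGp v₁ : Set P) =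
      DoubleCoset.doubleCoset x₂ (V : Set P) (G.vertGp v₂ : Set P) := by
  unfold vertexOver at h
  obtain ⟨rfl, h2⟩ := Sigma.mk.inj_iff.mp h
  refine ⟨rfl, ?_⟩
  obtain ⟨u, hu, k, hk, hx⟩ := (dcIdx_eq_iff V (G.vertGp v₁)).mp (eq_of_heq h2)
  exact (DoubleCoset.doubleCoset_eq_of_mem
    (DoubleCoset.mem_doubleCoset.mpr ⟨u, hu, k, hk, hx⟩)).symm

/-- For `H` normal in `Π_{G_V} = V`: the verticial subgroup of `G_V` (any branch data) at the vertex
`V x Π_v` lies in `H` iff the trace `V ∩ x Π_v x⁻¹` does ("trivial over the vertex" does not depend on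
the representative). [cite: MochizukiCombGC2007, Def 1.1(ii) p.6] -/
theorem restrictBD_vertGp_vertexOver_le_iff {H : Subgroup V} (hH : H.Normal) (v : G.graph.V) (x : P) :
    (G.restrictBD V hV bd).vertGp (G.vertexOver V v x) ≤ H ↔
      (ConjAct.toConjAct x • G.vertGp v).subgroupOf V ≤ H := by
  obtain ⟨u, hu⟩ := G.exists_restrictVertGp_vertexOver_eq V v x
  change G.restrictVertGp V (G.vertexOver V v x) ≤ H ↔ _
  rw [hu]
  constructor
  · intro h
    have h' := (Subgroup.pointwise_smul_le_pointwise_smul_iff (a := (ConjAct.toConjAct u)⁻¹)).mpr h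
    rwa [inv_smul_smul, hH.conjAct] at h'
  · intro h
    calc ConjAct.toConjAct u • (ConjAct.toConjAct x • G.vertGp v).subgroupOf V
        ≤ ConjAct.toConjAct u • H := Subgroup.pointwise_smul_le_pointwise_smul_iff.mpr h
      _ = H := hH.conjAct _

/-- **The level-`V` clause of `VerticialSeparatingCoverings` from the inputs at the covering datum
`G_V`** (`Π_G` profinite, `V` open of finite index, any branch data `bd`): if `G_V` is sturdy and
satisfies Rmk. 1.2.3 (iv)'s split injection (corrected form) and Rmk. 1.1.5's rank statement, then two
DISTINCT level-`V` vertices `(v₁, Vγ₁Π_{v₁}) ≠ (v₂, Vγ₂Π_{v₂})` are separated by an open `U ≤ V`, normal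
in `V`, with `γ₂Π_{v₂}γ₂⁻¹ ∩ V ⊆ U` and `γ₁Π_{v₁}γ₁⁻¹ ∩ V ⊄ U` — the image in `Π_G` of the subgroup of
`exists_openNormal_vertGp_le_not_le` for `G_V`. [cite: MochizukiCombGC2007, Prop 1.2 proof p.9] -/
theorem exists_separating_of_restrictBD [CompactSpace P] [T2Space P]
    (hsplit : (G.restrictBD V hV bd).UnrVerticialSplitInjection')
    (hrank : (G.restrictBD V hV bd).UnrVertAbOfRank) (hst : (G.restrictBD V hV bd).IsSturdy)
    (v₁ v₂ : G.graph.V) (γ₁ γ₂ : ConjAct P)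
    (hne : v₁ ≠ v₂ ∨
      DoubleCoset.doubleCoset (ConjAct.ofConjAct γ₁) (V : Set P) (G.vertGp v₁ : Set P) ≠
        DoubleCoset.doubleCoset (ConjAct.ofConjAct γ₂) (V : Set P) (G.vertGp v₂ : Set P)) :
    ∃ U : Subgroup P, IsOpen (U : Set P) ∧ U ≤ V ∧ (U.subgroupOf V).Normal ∧
      (γ₂ • G.vertGp v₂) ⊓ V ≤ U ∧ ¬ ((γ₁ • G.vertGp v₁) ⊓ V ≤ U) := by
  -- `V` is profinite
  have hVc : IsClosed (V : Set P) := Subgroup.isClosed_of_isOpen V hV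
  haveI : CompactSpace V := isCompact_iff_compactSpace.mp hVc.isCompact
  -- the two level-`V` vertices, as vertices of the covering datum `G_V`
  set w₁ := G.vertexOver V v₁ (ConjAct.ofConjAct γ₁) with hw₁
  set w₂ := G.vertexOver V v₂ (ConjAct.ofConjAct γ₂) with hw₂
  have hw : w₁ ≠ w₂ := by
    intro h
    obtain ⟨h1, h2⟩ := G.vertexOver_eq_imp V h
    exact hne.elim (fun h' => h' h1) (fun h' => h' h2)
  haveI : Nontrivial (G.restrictBD V hV bd).graph.V := ⟨⟨w₁, w₂, hw⟩⟩
  obtain ⟨H, hHn, hHo, h₂, h₁⟩ :=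
    (G.restrictBD V hV bd).exists_openNormal_vertGp_le_not_le
      (UnrVerticialSplitInjection'.toOld _ hsplit) hrank hst hw
  refine ⟨H.map V.subtype, ?_, Subgroup.map_subtype_le H, ?_, ?_, ?_⟩
  · -- open
    have e : ((H.map V.subtype : Subgroup P) : Set P) = Subtype.val '' (H : Set V) := by
      ext x; simp only [Subgroup.coe_map, Subgroup.coe_subtype, Set.mem_image, SetLike.mem_coe]
    rw [e]
    exact hV.isOpenMap_subtype_val _ hHo
  · -- normal in `V`
    rw [← Subgroup.comap_subtype, Subgroup.comap_map_eq_self_of_injective V.subtype_injective]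
    exact hHn
  · -- trivial over `v₂'`
    have h₂' : (ConjAct.toConjAct (ConjAct.ofConjAct γ₂) • G.vertGp v₂).subgroupOf V ≤ H :=
      (G.restrictBD_vertGp_vertexOver_le_iff V hV bd hHn v₂ _).mp h₂
    rw [ConjAct.toConjAct_ofConjAct] at h₂'
    intro x hx
    obtain ⟨hxA, hxV⟩ := Subgroup.mem_inf.mp hx
    have hxH : (⟨x, hxV⟩ : V) ∈ H := h₂' (Subgroup.mem_subgroupOf.mpr hxA)
    exact Subgroup.mem_map.mpr ⟨⟨x, hxV⟩, hxH, rfl⟩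
  · -- nontrivial over `v₁'`
    intro hle
    apply h₁
    refine (G.restrictBD_vertGp_vertexOver_le_iff V hV bd hHn v₁ _).mpr ?_
    rw [ConjAct.toConjAct_ofConjAct]
    intro y hy
    have hyU : (y : P) ∈ H.map V.subtype :=
      hle (Subgroup.mem_inf.mpr ⟨Subgroup.mem_subgroupOf.mp hy, y.2⟩)
    obtain ⟨z, hz, hzy⟩ := Subgroup.mem_map.mp hyU
    rwa [← Subtype.ext hzy]

end Restrict

/-! ### 3. The verticial separating-coverings statement from level-wise inputs -/

section Datum

variable [CompactSpace P] [T2Space P] (G : PSCDatum P)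

/-- **Row F-2826 for a datum on a profinite group, from level-wise inputs**: if below every open
normal `V ⊴ Π_G` there is an open normal level `V' ≤ V` (with some branch data) whose covering datum
`G_{V'}` is sturdy and satisfies the split injection (Rmk. 1.2.3 (iv), corrected form) and the rank
statement (Rmk. 1.1.5), then `G.VerticialSeparatingCoverings`.
[cite: MochizukiCombGC2007, Prop 1.2 proof p.9] -/
theorem verticialSeparatingCoverings_of_levelwise
    (h : ∀ V : Subgroup P, V.Normal → IsOpen (V : Set P) →
      ∃ (V' : Subgroup P) (_ : V'.FiniteIndex) (hV' : IsOpen (V' : Set P)) (bd : G.BranchData),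
        V'.Normal ∧ V' ≤ V ∧
        (G.restrictBD V' hV' bd).UnrVerticialSplitInjection' ∧ (G.restrictBD V' hV' bd).UnrVertAbOfRank ∧
        (G.restrictBD V' hV' bd).IsSturdy) :
    G.VerticialSeparatingCoverings := by
  intro V hVn hVo
  obtain ⟨V', _, hV'o, bd, hV'n, hle, hsplit, hrank, hst⟩ := h V hVn hVo
  exact ⟨V', hV'n, hV'o, hle, fun v₁ v₂ γ₁ γ₂ hne =>
    G.exists_separating_of_restrictBD V' hV'o bd hsplit hrank hst v₁ v₂ γ₁ γ₂ hne⟩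

/-- **Row F-2826 for a STURDY datum on a profinite group** whose covering data `G_V` (`V` open
normal, fixed branch data) all satisfy the split injection and the rank statement: every level is then
sturdy (`IsSturdy.restrictBD`, Riemann–Hurwitz), so `V' := V` serves.
[cite: MochizukiCombGC2007, Prop 1.2 proof p.9] -/
theorem verticialSeparatingCoverings_of_sturdy (hGs : G.IsSturdy) (bd : G.BranchData)
    (h : ∀ (V : Subgroup P) [V.FiniteIndex] (hV : IsOpen (V : Set P)), V.Normal →
      (G.restrictBD V hV bd).UnrVerticialSplitInjection' ∧ (G.restrictBD V hV bd).UnrVertAbOfRank) :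
    G.VerticialSeparatingCoverings := by
  refine G.verticialSeparatingCoverings_of_levelwise fun V hVn hVo => ?_
  haveI : V.FiniteIndex := finiteIndex_of_isOpen V hVo
  obtain ⟨hsplit, hrank⟩ := h V hVo hVn
  exact ⟨V, inferInstance, hVo, bd, hVn, le_rfl, hsplit, hrank, IsSturdy.restrictBD G V hVo bd hGs⟩

end Datum

/-! ### 4. Over the origin predicate -/

section Origin

variable (Ω : PSCOrigin.{u})

/-- **Row F-2826 over an origin predicate `Ω`, every input an origin statement BY NAME**: "coverings
of PSC-type data are of PSC-type" (`RestrictBDOfPSCTypeHolds Ω`), [CombGC] Rmk. 1.1.5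
(`SturdyCoverHolds Ω`: a sturdy characteristic open subgroup exists, and Def. 1.1 (ii)'s rank-sturdiness
at the trivial level is genus-sturdiness), the split injection of [IUTchI] Rmk. 1.2.3 (iv) in corrected
form for every `Ω`-datum (displayed; supplied by `UnrVerticialCharacterizationHolds' Ω`, see the primed
corollary), Rmk. 1.1.5's rank statement (`UnrVertAbOfRankHolds Ω`), and profiniteness of the `Π_G` of
`Ω`-data (displayed `hprof`).  Given `V`, descend to `V' := V ∩ H` (`H` the sturdy characteristic
subgroup), whose covering datum is of `Ω`-type, sturdy, and carries the two inputs.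
[cite: MochizukiCombGC2007, Prop 1.2 proof p.9] -/
theorem verticialSeparatingCoverings_of_origin
    (hres : RestrictBDOfPSCTypeHolds Ω) (hstc : SturdyCoverHolds Ω)
    (hsplit : ∀ ⦃Q : Type u⦄ [Group Q] [TopologicalSpace Q] [IsTopologicalGroup Q] (G : PSCDatum Q),
      Ω.IsOfPSCType G → G.UnrVerticialSplitInjection')
    (hrank : UnrVertAbOfRankHolds Ω)
    (hprof : ∀ ⦃Q : Type u⦄ [Group Q] [TopologicalSpace Q] [IsTopologicalGroup Q] (G : PSCDatum Q),
      Ω.IsOfPSCType G → CompactSpace Q ∧ TotallyDisconnectedSpace Q)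
    {Q : Type u} [Group Q] [TopologicalSpace Q] [IsTopologicalGroup Q] (G : PSCDatum Q)
    (hG : Ω.IsOfPSCType G) : G.VerticialSeparatingCoverings := by
  obtain ⟨hc, htd⟩ := hprof G hG
  haveI : T2Space Q := inferInstance
  refine G.verticialSeparatingCoverings_of_levelwise fun V hVn hVo => ?_
  obtain ⟨-, H, hHo, hHchar, hHst⟩ := hstc G hG
  haveI := hHchar
  obtain ⟨bd, hbd⟩ := hres G hG
  have hV'o : IsOpen ((V ⊓ H : Subgroup Q) : Set Q) := by
    rw [Subgroup.coe_inf]; exact hVo.inter hHo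
  haveI : (V ⊓ H).FiniteIndex := finiteIndex_of_isOpen _ hV'o
  have hG' : Ω.IsOfPSCType (G.restrictBD (V ⊓ H) hV'o bd) := hbd (V ⊓ H) hV'o
  refine ⟨V ⊓ H, inferInstance, hV'o, bd, inferInstance, inf_le_left, hsplit _ hG', hrank _ hG', ?_⟩
  have h1 : G.IsSturdyAt (V ⊓ H) := hHst _ hV'o inf_le_right
  exact (hstc _ hG').1.mp ((G.isSturdyAt_restrictBD_top_iff (V ⊓ H) hV'o bd).mpr h1)

/-- **Row F-2826 over `Ω` from the named statements** `RestrictBDOfPSCTypeHolds Ω`, `SturdyCoverHolds Ω`,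
`UnrVerticialCharacterizationHolds' Ω` (the corrected successor of F-1938), `UnrVertAbOfRankHolds Ω`
and profiniteness. [cite: MochizukiCombGC2007, Prop 1.2 proof p.9] -/
theorem verticialSeparatingCoverings_of_origin'
    (hres : RestrictBDOfPSCTypeHolds Ω) (hstc : SturdyCoverHolds Ω)
    (hunr : UnrVerticialCharacterizationHolds' Ω) (hrank : UnrVertAbOfRankHolds Ω)
    (hprof : ∀ ⦃Q : Type u⦄ [Group Q] [TopologicalSpace Q] [IsTopologicalGroup Q] (G : PSCDatum Q),
      Ω.IsOfPSCType G → CompactSpace Q ∧ TotallyDisconnectedSpace Q)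
    {Q : Type u} [Group Q] [TopologicalSpace Q] [IsTopologicalGroup Q] (G : PSCDatum Q)
    (hG : Ω.IsOfPSCType G) : G.VerticialSeparatingCoverings :=
  verticialSeparatingCoverings_of_origin Ω hres hstc (fun _ _ _ _ G' hG' => (hunr G' hG').1) hrank
    hprof G hG

/-- The same with the FROZEN `UnrVerticialCharacterizationHolds Ω` (row F-1938, the binder of
`PSCThm16iiiAssemblyProofs.unrVerticialIff_holds_of_inputs`; it implies its successor for all data).
[cite: MochizukiCombGC2007, Prop 1.2 proof p.9] -/
theorem verticialSeparatingCoverings_of_origin_frozen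
    (hres : RestrictBDOfPSCTypeHolds Ω) (hstc : SturdyCoverHolds Ω)
    (hunr : UnrVerticialCharacterizationHolds Ω) (hrank : UnrVertAbOfRankHolds Ω)
    (hprof : ∀ ⦃Q : Type u⦄ [Group Q] [TopologicalSpace Q] [IsTopologicalGroup Q] (G : PSCDatum Q),
      Ω.IsOfPSCType G → CompactSpace Q ∧ TotallyDisconnectedSpace Q)
    {Q : Type u} [Group Q] [TopologicalSpace Q] [IsTopologicalGroup Q] (G : PSCDatum Q)
    (hG : Ω.IsOfPSCType G) : G.VerticialSeparatingCoverings :=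
  verticialSeparatingCoverings_of_origin' Ω hres hstc hunr.toPrime hrank hprof G hG

end Origin

end PSCDatum

end Literature.AnabelianGeometry.SemiGraphs
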